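import Summits.Ventures.PercRepro.ProfilePointedCircuitClassesSevenB

/-!
# PercRepro — THE IN–OUT INEQUALITY AT `ρ = 7`, III: THE UNITS' SIDE ON A `5`-POINT SET
(p5, gen 41; `proofs/P5-GM1.md` §61)

For a `5`-point set `T` (the complement of a unit, minus `e`) the demands disjoint from the unit are the
`3`-subsets `W₀ ⊆ T` with `W₀ + e` a basis (so `ρ(W₀) = 3`), and the demands CHARGING the unit are those with
`T ∖ W₀` a parallel pair.  **`2·#{W₀ : T ∖ W₀ parallel} + 3·#{W₀ : ρ(W₀) = 3} ≤ 30`**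
(`two_mul_card_add_three_mul_card_le_thirty`): the first count is the number `π` of parallel pairs of `T`
(`W₀ ↦ T ∖ W₀`), each parallel pair lies in three `3`-subsets of `T` and a `3`-subset of rank `3` contains none, so
`π ≤ #{W₀ : ρ(W₀) ≠ 3}` by double counting (`card_filter_le_card_filter_not_rk_eq_three`), and the ten `3`-subsets
split as `#{ρ = 3} + #{ρ ≠ 3}`.
-/

open scoped Matroid

namespace PercRepro.Cogirth

open Finset ThmH Skew Shadow Profile

variable {α : Type} [DecidableEq α] {M : Matroid α} [M.Finite]

section SevenC

/-- The `3`-subsets with a parallel complement are at most the parallel pairs (`W₀ ↦ T ∖ W₀`). -/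
theorem card_filter_sdiff_le_card_filter_pair {T : Finset α} (hT5 : T.card = 5) :
    ((T.powersetCard 3).filter (fun W₀ => rk M (T \ W₀) ≤ 1)).card ≤
      ((T.powersetCard 2).filter (fun Y => rk M Y ≤ 1)).card := by
  apply card_le_card_of_injOn (fun W₀ => T \ W₀)
  · intro W₀ hW₀
    rw [mem_coe, mem_filter, mem_powersetCard] at hW₀
    rw [mem_coe, mem_filter, mem_powersetCard]
    refine ⟨⟨sdiff_subset, ?_⟩, hW₀.2⟩
    rw [card_sdiff_of_subset hW₀.1.1, hW₀.1.2, hT5]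
  · intro W₀ hW₀ W₁ hW₁ h
    rw [mem_coe, mem_filter, mem_powersetCard] at hW₀ hW₁
    simp only at h
    rw [← Finset.sdiff_sdiff_eq_self hW₀.1.1, ← Finset.sdiff_sdiff_eq_self hW₁.1.1, h]

/-- **A parallel pair of `T` lies in three `3`-subsets, a `3`-subset of rank `3` contains no parallel pair**: the
parallel pairs of a `5`-set `T` are at most the `3`-subsets of rank `≠ 3` (double counting the incidences
`Y ⊆ W₀`). -/
theorem card_filter_le_card_filter_not_rk_eq_three {T : Finset α} (hT5 : T.card = 5) :
    ((T.powersetCard 2).filter (fun Y => rk M Y ≤ 1)).card ≤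
      ((T.powersetCard 3).filter (fun W₀ => ¬ rk M W₀ = 3)).card := by
  set P := (T.powersetCard 2).filter (fun Y => rk M Y ≤ 1) with hPdef
  set Q := T.powersetCard 3 with hQdef
  have hdc : ∑ Y ∈ P, (Q.filter (fun W₀ => Y ⊆ W₀)).card = ∑ W₀ ∈ Q, (P.filter (fun Y => Y ⊆ W₀)).card := by
    have h := sum_card_bipartiteAbove_eq_sum_card_bipartiteBelow
      (r := fun (Y W₀ : Finset α) => Y ⊆ W₀) (s := P) (t := Q)
    simp only [bipartiteAbove, bipartiteBelow] at h
    exact h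
  -- every parallel pair lies in three `3`-subsets
  have hlow : ∀ Y ∈ P, 3 ≤ (Q.filter (fun W₀ => Y ⊆ W₀)).card := by
    intro Y hY
    rw [hPdef, mem_filter, mem_powersetCard] at hY
    have h3 : (T \ Y).card = 3 := by rw [card_sdiff_of_subset hY.1.1, hT5, hY.1.2]
    calc 3 = (T \ Y).card := h3.symm
      _ ≤ _ := by
        apply card_le_card_of_injOn (fun t => insert t Y)
        · intro t ht
          rw [mem_coe, mem_sdiff] at ht
          rw [mem_coe, mem_filter, hQdef, mem_powersetCard]
          refine ⟨⟨insert_subset ht.1 hY.1.1, ?_⟩, subset_insert t Y⟩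
          rw [card_insert_of_notMem ht.2, hY.1.2]
        · intro t ht t' ht' h
          rw [mem_coe, mem_sdiff] at ht ht'
          simp only at h
          have : t ∈ insert t' Y := by rw [← h]; exact mem_insert_self t Y
          rw [mem_insert] at this
          rcases this with h' | h'
          · exact h'
          · exact absurd h' ht.2
  -- a `3`-subset of rank `3` contains no parallel pair; any `3`-subset contains at most three pairs
  have hup : ∀ W₀ ∈ Q, (P.filter (fun Y => Y ⊆ W₀)).card ≤ if rk M W₀ = 3 then 0 else 3 := by
    intro W₀ hW₀
    rw [hQdef, mem_powersetCard] at hW₀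
    split_ifs with h3
    · apply Nat.le_zero.2
      rw [card_eq_zero, filter_eq_empty_iff]
      intro Y hY hYW
      rw [hPdef, mem_filter, mem_powersetCard] at hY
      -- `ρ(W₀) ≤ ρ(Y) + #(W₀ ∖ Y) ≤ 1 + 1`
      have h1 := rk_union_le (M := M) Y (W₀ \ Y)
      rw [union_sdiff_of_subset hYW] at h1
      have h2 := rk_le_card (M := M) (W₀ \ Y)
      rw [card_sdiff_of_subset hYW, hW₀.2, hY.1.2] at h2
      omega
    · calc (P.filter (fun Y => Y ⊆ W₀)).card ≤ (W₀.powersetCard 2).card := by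
            apply card_le_card
            intro Y hY
            rw [mem_filter, hPdef, mem_filter, mem_powersetCard] at hY
            rw [mem_powersetCard]
            exact ⟨hY.2, hY.1.1.2⟩
        _ = 3 := by rw [card_powersetCard, hW₀.2]; decide
  have h1 : 3 * P.card ≤ ∑ Y ∈ P, (Q.filter (fun W₀ => Y ⊆ W₀)).card := by
    have := card_nsmul_le_sum P (fun Y => (Q.filter (fun W₀ => Y ⊆ W₀)).card) 3 hlow
    rw [smul_eq_mul] at this
    omega
  have h2 : ∑ W₀ ∈ Q, (P.filter (fun Y => Y ⊆ W₀)).card ≤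
      3 * (Q.filter (fun W₀ => ¬ rk M W₀ = 3)).card := by
    have e : (Q.filter (fun W₀ => ¬ rk M W₀ = 3)).card = ∑ W₀ ∈ Q, if rk M W₀ = 3 then 0 else 1 := by
      rw [card_filter]
      apply sum_congr rfl
      intro W₀ _
      split_ifs <;> rfl
    rw [e, mul_sum]
    apply sum_le_sum
    intro W₀ hW₀
    have := hup W₀ hW₀
    split_ifs at this ⊢ <;> omega
  omega

/-- **The units' side**: on a `5`-point set `T`,
`2·#{W₀ ∈ C(T,3) : T ∖ W₀ parallel} + 3·#{W₀ ∈ C(T,3) : ρ(W₀) = 3} ≤ 30`. -/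
theorem two_mul_card_add_three_mul_card_le_thirty {T : Finset α} (hT5 : T.card = 5) :
    2 * ((T.powersetCard 3).filter (fun W₀ => rk M (T \ W₀) ≤ 1)).card +
      3 * ((T.powersetCard 3).filter (fun W₀ => rk M W₀ = 3)).card ≤ 30 := by
  have h1 := card_filter_sdiff_le_card_filter_pair (M := M) hT5
  have h2 := card_filter_le_card_filter_not_rk_eq_three (M := M) hT5
  have h3 := card_filter_add_card_filter_not (s := T.powersetCard 3) (fun W₀ => rk M W₀ = 3)
  rw [card_powersetCard, hT5] at h3
  have h10 : Nat.choose 5 3 = 10 := by decide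
  rw [h10] at h3
  omega

end SevenC

end PercRepro.Cogirth
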